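import Summits.HodgeConjecture.HodgeConjecture.Theorems.NikulinTwinTransportSquareTypeTwoTwo
import Summits.HodgeConjecture.HodgeConjecture.Theorems.NikulinTwinTransportRealMultiplicationFibreIntegral

/-!
# Route NikulinTwinTransport · item `SquareHodgeOfSqrtTwo` (stmt-HodgeConjecture-13680) —
# the Hodge conjecture for `S ⊗ S`, from the Künneth spanning property and the route's standard inputs

Assembly of the Künneth bookkeeping (`…SquareKunneth`, `…SquarePairing`, `…SquareHodgeTypes`,
`…SquareRationality`, `…SquareTranscendental`, `…SquareTypeTwoTwo`). For a projective K3 surface `S`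
with `End_Hdg(T(S))_ℚ = ℚ + ℚ·e`, `e² = 2` (the hypotheses of the item), the Hodge conjecture for the
fourfold `S ⊗ S` holds GRANTED:

* the Künneth spanning property over `ℂ` (`hK`, in the universal shape of the sibling file
  `…HodgeIsometryAlgebraicGysinBaseChange`; Hatcher Thm. 3.15/3.16) and `b₁ = 0` for projective K3
  surfaces (`hb₁`; Huybrechts Ch. 1 §3.2: `H¹(X, ℤ) = 0`);
* the named facts `nonempty_hodgeModel` (Hodge models of `S ⊗ S`), the multiplicativity of Hodge types
  `CupPreservesHodgeType` (the tree's theorem from de Rham's theorem, `cupPreservesHodgeType_of_…`),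
  `Grothendieck1969_supportedClasses_le_hodgeConiveau` (`N¹H² ⊆ H^{1,1}`), `hodgeIndex_surface`
  (Hodge index), `Huybrechts_K3_marking_exists` (markings);
* the route items `RealMultiplicationSqrtTwoAlgebraic` (the class of `e` is algebraic) and
  `LefschetzOneOneK3`.

Degrees: `p = 0` trivial, `p = 4` top classes (`mem_algebraicClasses_of_degree_top`), `p ≥ 5` no
classes; `p = 1, 3` the Künneth components are rational `(1,1)`-classes, hence divisors, and
`fst^* a + snd^* b`, `fst^* a ∪ snd^* p + fst^* p ∪ snd^* b` are algebraic; `p = 2` is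
`mem_algebraicClasses_of_typeTwoTwo`. Consequently the glue item `SquareGlue`
(stmt-HodgeConjecture-13682) follows from the same standard inputs (`squareGlue_of_kunneth`), the
Künneth criterion (K) left as FORMAL DEBT by the sibling file `…SquareHodgeOfSqrtTwo`
(`squareHodgeOfSqrtTwo_of_kunnethCriterion`, seat pitem-13680-0) is DISCHARGED from them
(`kunnethCriterion_of_kunneth`, through the simpler variant `hodgeConjectureFor_square_of_endomorphisms`:
when every rational Hodge endomorphism of `H²` is induced by an algebraic class, a middle Künneth
component is `c₀ •` the middle part of that class), and with
`realMultiplicationSqrtTwoAlgebraic_of_kunneth` (`…RealMultiplicationFibreIntegral`) the frame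
`Assembly` reduces to the standard inputs (`assembly_of_kunneth`).

## References

* [Varesco2023] M. Varesco, Hodge similitudes and the Hodge conjecture for squares of K3 surfaces
  (2023), §2 (p. 8), Thm. 2.1, Rem. 2.2.
* [VoisinHodgeI2002] C. Voisin, Hodge Theory and Complex Algebraic Geometry I, CUP 2002, §11.3.3
  Lemma 11.41, Thm. 11.30.
* [HatcherAT2002] A. Hatcher, Algebraic Topology, CUP 2002, §3.2 Thm. 3.15–3.16.
* [Huybrechts2016K3] D. Huybrechts, Lectures on K3 Surfaces, CUP 2016, Ch. 1 §3.2, Prop. 3.5; Ch. 3.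
* [Deligne2000] P. Deligne, The Hodge conjecture, Clay 2000, §1.
-/

noncomputable section

open scoped Manifold
open CategoryTheory AlgebraicGeometry MonoidalCategory CartesianMonoidalCategory
open Literature.AlgebraicGeometry.Motives Literature.AlgebraicGeometry.HodgeTheory
open Literature.AlgebraicGeometry.Surfaces Literature.Geometry.Kaehler
open Literature.AlgebraicTopology.SingularHomology

namespace Summit.HodgeConjecture.HodgeConjecture.Theorems.NikulinTwinTransport

/-- **The Hodge conjecture for the square of a projective K3 surface `S` with
`End_Hdg(T(S))_ℚ = ℚ + ℚ·e`, granted that the class of `e` is algebraic, Lefschetz `(1,1)` for `S`, and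
the standard inputs** (Künneth spanning for `(S, S)`, `b₁(S) = 0`, a Hodge model of `S ⊗ S`, the
multiplicativity of Hodge types on `S` and `S ⊗ S`, the Hodge index theorem for `S`, `N¹H²(S) ⊆ H^{1,1}`
and a marking of `S`). [cite: Varesco2023, §2 (p. 8)] [cite: VoisinHodgeI2002, §11.3.3 Lemma 11.41]
[cite: Deligne2000, §1] -/
theorem hodgeConjectureFor_square (μ : OrientationFamily) {S : SchemeOver ℂ} (hK3 : IsK3Surface S)
    [Subsingleton (complexBetti S 1)]
    (hKS : ∀ (k : ℕ) (z : complexBetti (S ⊗ S) k), z ∈ Submodule.span ℂ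
      {v | ∃ (i j : ℕ) (h : i + j = k) (a : complexBetti S i) (w : complexBetti S j),
        v = cupProduct h (complexBetti.map (fst S S) i a) (complexBetti.map (snd S S) j w)})
    (M : HodgeModel 4 (S ⊗ S)) (hcupS : CupPreservesHodgeType 2 S) (hcupP : CupPreservesHodgeType 4 (S ⊗ S))
    (hHI : hodgeIndex_surface S)
    (hN11 : ∀ d ∈ algebraicClasses S 1, IsOfHodgeType 2 S (2 * 1) 1 1 d)
    (hL11 : ∀ c : complexBetti S (2 * 1), IsRationalClass c → IsOfHodgeType 2 S (2 * 1) 1 1 c →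
      c ∈ algebraicClasses S 1)
    (η : complexBetti S (2 * 1) ≃ₗ[ℂ] (K3Index → ℂ)) {p : complexBetti S (2 * 2)} (hp0 : p ≠ 0)
    (hpint : IsIntegralClass p)
    (hint : ∀ c : complexBetti S (2 * 1), IsIntegralClass c ↔ ∃ v : K3Index → ℤ, η c = fun i => (v i : ℂ))
    (hcup : ∀ a b : complexBetti S (2 * 1),
      cupProduct (rfl : 2 * 1 + 2 * 1 = 2 * 2) a b = k3Form (η a) (η b) • p)
    (e : complexBetti S (2 * 1) →ₗ[ℂ] complexBetti S (2 * 1))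
    (he_N : ∀ d ∈ algebraicClasses S 1, e d = 0)
    (hEnd : ∀ (f : complexBetti S (2 * 1) →ₗ[ℂ] complexBetti S (2 * 1)),
      (∀ x, IsRationalClass x → IsRationalClass (f x)) →
      (∀ (i j : ℕ) x, IsOfHodgeType 2 S (2 * 1) i j x → IsOfHodgeType 2 S (2 * 1) i j (f x)) →
      (∀ d ∈ algebraicClasses S 1, f d = 0) →
      (∀ x : complexBetti S (2 * 1), ∀ d ∈ algebraicClasses S 1,
        cupProduct (rfl : 2 * 1 + 2 * 1 = 2 * 2) (f x) d = 0) →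
      ∃ a b : ℚ, ∀ x : complexBetti S (2 * 1),
        (∀ d ∈ algebraicClasses S 1, cupProduct (rfl : 2 * 1 + 2 * 1 = 2 * 2) x d = 0) →
        f x = (a : ℂ) • x + (b : ℂ) • e x)
    (hγ : ∃ γ ∈ algebraicClasses (S ⊗ S) 2, ∀ x : complexBetti S (2 * 1),
      e x = complexGysin μ (IsSmoothProjective.tensor_holds hK3.isSmoothProjective hK3.isSmoothProjective)
        hK3.isSmoothProjective (fst S S) (rfl : 2 * 1 + 2 * 2 + 2 * 2 = 2 * 1 + 2 * (2 + 2))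
        (cupProduct (rfl : 2 * 1 + 2 * 2 = 2 * 1 + 2 * 2) (complexBetti.map (snd S S) (2 * 1) x) γ)) :
    HodgeConjectureFor 4 (S ⊗ S) := by
  have hS := hK3.isSmoothProjective
  have hP : IsSmoothProjective 4 (S ⊗ S) := IsSmoothProjective.tensor_holds hS hS
  obtain ⟨A⟩ := hK3.nonempty_hodgeModel
  have hpp := cross_top_ne_zero μ hS (hKS _) hp0
  have hBs : ∀ a b : complexBetti S (2 * 1), k3Form (η a) (η b) = k3Form (η b) (η a) :=
    fun a b ↦ k3Form_comm _ _
  have h1 : singularCohomology.one ℂ (ComplexPoints S) ∈ algebraicClasses S 0 := by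
    rw [algebraicClasses_zero]; exact Submodule.mem_top
  have hpalg : p ∈ algebraicClasses S 2 := mem_algebraicClasses_of_degree_top hS (by norm_num) p
  refine ⟨⟨M⟩, fun q ↦ ?_⟩
  match q with
  | 0 => exact fun c _ _ ↦ hodgeConjectureFor_codim_zero c
  | 1 =>
    intro c hc h11
    obtain ⟨a, b, hcn⟩ := kunneth_two μ hS hKS c
    obtain ⟨har, hbr⟩ := isRationalClass_of_kunneth_two hK3 η hint hcup hpint hpp hc hcn
    obtain ⟨ha1, hb1⟩ := isOfHodgeType_of_kunneth_two μ hS A M hcupS hcupP hcup hpp h11 hcn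
    have ha : complexBetti.map (fst S S) (2 * 1) a ∈ algebraicClasses (S ⊗ S) 1 := by
      have h := cupProduct_map_fst_map_snd_mem_algebraicClasses hS hS (l := 1) (k := 0) (hL11 a har ha1) h1
      rwa [singularCohomology.map_one, cupProduct_one] at h
    have hb : complexBetti.map (snd S S) (2 * 1) b ∈ algebraicClasses (S ⊗ S) 1 := by
      have h := cupProduct_map_fst_map_snd_mem_algebraicClasses hS hS (l := 0) (k := 1) h1 (hL11 b hbr hb1)
      rwa [singularCohomology.map_one, one_cupProduct] at h
    rw [hcn]
    exact Submodule.add_mem _ ha hb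
  | 2 =>
    exact fun c hc h22 ↦ mem_algebraicClasses_of_typeTwoTwo μ hK3 η hp0 hpint hint hcup hKS A M hcupS hcupP
      hHI hN11 hL11 e he_N hEnd hγ hc h22
  | 3 =>
    intro c hc h33
    obtain ⟨a, b, hcn⟩ := kunneth_six μ hS hKS hp0 c
    obtain ⟨har, hbr⟩ := isRationalClass_of_kunneth_six hK3 η hint hcup hpint hpp hc hcn
    obtain ⟨ha1, hb1⟩ := isOfHodgeType_of_kunneth_six μ hS A M hcupS hcupP hcup hpp h33 hcn
    rw [hcn]
    exact Submodule.add_mem _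
      (cupProduct_map_fst_map_snd_mem_algebraicClasses hS hS (l := 1) (k := 2) (hL11 a har ha1) hpalg)
      (cupProduct_map_fst_map_snd_mem_algebraicClasses hS hS (l := 2) (k := 1) hpalg (hL11 b hbr hb1))
  | 4 => exact fun c _ _ ↦ mem_algebraicClasses_of_degree_top hP (by norm_num) c
  | q + 5 =>
    intro c _ _
    haveI := subsingleton_complexBetti hP (show 2 * 4 < 2 * (q + 5) by omega)
    rw [Subsingleton.elim c 0]
    exact Submodule.zero_mem _

/-- **The sector item `SquareHodgeOfSqrtTwo` (stmt-HodgeConjecture-13680) from the route items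
`RealMultiplicationSqrtTwoAlgebraic`, `LefschetzOneOneK3` and the standard inputs**: the Künneth
spanning property over `ℂ` (`hK`), `b₁ = 0` for projective K3 surfaces (`hb₁`), Hodge models
(`nonempty_hodgeModel`), the multiplicativity of Hodge types (`CupPreservesHodgeType`, the tree's
theorem from de Rham's theorem), `N¹H² ⊆ H^{1,1}` (`Grothendieck1969_supportedClasses_le_hodgeConiveau`),
the Hodge index theorem (`hodgeIndex_surface`) and markings (`Huybrechts_K3_marking_exists`). This is
the content of the glue item `SquareGlue` (the Künneth bookkeeping, Varesco 2023 p. 8), kernel-checked.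
[cite: Varesco2023, §2 (p. 8)] [cite: VoisinHodgeI2002, §11.3.3 Lemma 11.41] [cite: HatcherAT2002, §3.2 Thm. 3.16]
[cite: Huybrechts2016K3, Ch. 1 §3.2 and Prop. 3.5] -/
theorem squareHodgeOfSqrtTwo_of_kunneth
    (hK : ∀ ⦃m' n' : ℕ⦄ ⦃Y' Z' : SchemeOver ℂ⦄, IsSmoothProjective m' Y' → IsSmoothProjective n' Z' →
      ∀ (k : ℕ) (z : complexBetti (Y' ⊗ Z') k), z ∈ Submodule.span ℂ
        {v | ∃ (i j : ℕ) (h : i + j = k) (b : complexBetti Y' i) (w : complexBetti Z' j),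
          v = cupProduct h (complexBetti.map (fst Y' Z') i b) (complexBetti.map (snd Y' Z') j w)})
    (hb₁ : ∀ S : SchemeOver ℂ, IsK3Surface S → Subsingleton (complexBetti S 1))
    (hM : ∀ (n : ℕ) (X : SchemeOver ℂ), nonempty_hodgeModel n X)
    (hcupT : ∀ (n : ℕ) (X : SchemeOver ℂ), IsSmoothProjective n X → CupPreservesHodgeType n X)
    (hG : Grothendieck1969_supportedClasses_le_hodgeConiveau)
    (hHI : ∀ X : SchemeOver ℂ, hodgeIndex_surface X)
    (hmark : Huybrechts_K3_marking_exists)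
    (hRM : Theses.NikulinTwinTransport.RealMultiplicationSqrtTwoAlgebraic)
    (hL11 : Theses.NikulinTwinTransport.LefschetzOneOneK3) :
    Theses.NikulinTwinTransport.SquareHodgeOfSqrtTwo := by
  intro S hS e he_rat he_typ he_adj he_N he_T hEnd
  have hK3 : IsK3Surface S := hS
  haveI := hb₁ S hK3
  let μ : OrientationFamily := fun _ _ h ↦ Classical.choice (ComplexPoints.isOrientableOver ℂ h)
  have hP : IsSmoothProjective 4 (S ⊗ S) := IsSmoothProjective.tensor_holds hK3.isSmoothProjective hK3.isSmoothProjective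
  obtain ⟨M⟩ := (hM 4 (S ⊗ S)).nonempty hP
  obtain ⟨η, p, _, hp0, ⟨hpint, -, hint, hcup, -, -⟩, -⟩ := hmark.elim hK3
  exact hodgeConjectureFor_square μ hK3 (hK hK3.isSmoothProjective hK3.isSmoothProjective) M
    (hcupT 2 S hK3.isSmoothProjective) (hcupT 4 (S ⊗ S) hP) (hHI S)
    (fun d hd ↦ isOfHodgeType_oneOne_of_mem_algebraicClasses hG hK3 hd) (hL11 S hS) η hp0 hpint hint hcup
    e he_N hEnd (hRM μ (OrientationFamily.hasPoincareDuality μ) S hS e he_rat he_typ he_adj he_N he_T)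

/-- **The glue item `SquareGlue` (stmt-HodgeConjecture-13682) from the standard inputs** (its stated
antecedents `RealMultiplicationSqrtTwoAlgebraic`, `LefschetzOneOneK3` are consumed as such).
[cite: Varesco2023, §2 (p. 8)] -/
theorem squareGlue_of_kunneth
    (hK : ∀ ⦃m' n' : ℕ⦄ ⦃Y' Z' : SchemeOver ℂ⦄, IsSmoothProjective m' Y' → IsSmoothProjective n' Z' →
      ∀ (k : ℕ) (z : complexBetti (Y' ⊗ Z') k), z ∈ Submodule.span ℂ
        {v | ∃ (i j : ℕ) (h : i + j = k) (b : complexBetti Y' i) (w : complexBetti Z' j),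
          v = cupProduct h (complexBetti.map (fst Y' Z') i b) (complexBetti.map (snd Y' Z') j w)})
    (hb₁ : ∀ S : SchemeOver ℂ, IsK3Surface S → Subsingleton (complexBetti S 1))
    (hM : ∀ (n : ℕ) (X : SchemeOver ℂ), nonempty_hodgeModel n X)
    (hcupT : ∀ (n : ℕ) (X : SchemeOver ℂ), IsSmoothProjective n X → CupPreservesHodgeType n X)
    (hG : Grothendieck1969_supportedClasses_le_hodgeConiveau)
    (hHI : ∀ X : SchemeOver ℂ, hodgeIndex_surface X)
    (hmark : Huybrechts_K3_marking_exists) :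
    Theses.NikulinTwinTransport.SquareGlue :=
  fun hRM hL11 ↦ squareHodgeOfSqrtTwo_of_kunneth hK hb₁ hM hcupT hG hHI hmark hRM hL11

/-- **The frame `Assembly` (stmt-HodgeConjecture-13942) with both glue items discharged from the
standard inputs**: X + Buskin + TwinExists + Lefschetz `(1,1)` + the (unclaimed) sector complement
decide the summit, GRANTED the Künneth spanning property, `b₁ = 0`, Hodge models, multiplicativity of
Hodge types, Hodge index, `N¹H² ⊆ H^{1,1}`, markings and the K3 Hodge types of `H²`.
[cite: Varesco2023, Thm. 2.1, Rem. 2.2 and §2 (p. 8)] -/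
theorem assembly_of_kunneth
    (hK : ∀ ⦃m' n' : ℕ⦄ ⦃Y' Z' : SchemeOver ℂ⦄, IsSmoothProjective m' Y' → IsSmoothProjective n' Z' →
      ∀ (k : ℕ) (z : complexBetti (Y' ⊗ Z') k), z ∈ Submodule.span ℂ
        {v | ∃ (i j : ℕ) (h : i + j = k) (b : complexBetti Y' i) (w : complexBetti Z' j),
          v = cupProduct h (complexBetti.map (fst Y' Z') i b) (complexBetti.map (snd Y' Z') j w)})
    (hb₁ : ∀ S : SchemeOver ℂ, IsK3Surface S → Subsingleton (complexBetti S 1))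
    (hM : ∀ (n : ℕ) (X : SchemeOver ℂ), nonempty_hodgeModel n X)
    (hcupT : ∀ (n : ℕ) (X : SchemeOver ℂ), IsSmoothProjective n X → CupPreservesHodgeType n X)
    (hG : Grothendieck1969_supportedClasses_le_hodgeConiveau)
    (hHI : ∀ X : SchemeOver ℂ, hodgeIndex_surface X)
    (hmark : Huybrechts_K3_marking_exists) (hHT : Huybrechts_K3_hodgeTypes_H2) :
    Theses.NikulinTwinTransport.Assembly :=
  fun hX _ _ h₁ h₇ ↦ h₇ (squareGlue_of_kunneth hK hb₁ hM hcupT hG hHI hmark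
    (realMultiplicationSqrtTwoAlgebraic_of_kunneth hX hmark hHT hG hK) h₁)

/-! ### The Künneth criterion (K): when ALL rational Hodge endomorphisms of `H²` are algebraic -/

/-- **Rational `(2,2)`-classes on `S ⊗ S` are algebraic when every rational type-preserving
endomorphism of `H²(S(ℂ); ℂ)` is induced by an algebraic class**: the endomorphism `f` read off from
the middle Künneth component of a rational `(2,2)`-class `c` is a rational Hodge endomorphism
(`…SquareHodgeTypes`, `…SquareRationality`), hence `f = [γ]_*` with `γ` algebraic; a middle Künneth
datum is determined by its action (`eq_zero_of_act_eq_zero`), so the middle component of `c` is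
`c₀ •` the middle component of `γ`. [cite: Varesco2023, §2 (p. 8)] [cite: VoisinHodgeI2002, §11.3.3 Lemma 11.41] -/
theorem mem_algebraicClasses_of_typeTwoTwo_of_endomorphisms (μ : OrientationFamily) {S : SchemeOver ℂ}
    (hK3 : IsK3Surface S) (η : complexBetti S (2 * 1) ≃ₗ[ℂ] (K3Index → ℂ)) {p : complexBetti S (2 * 2)}
    (hp0 : p ≠ 0) (hpint : IsIntegralClass p)
    (hint : ∀ c : complexBetti S (2 * 1), IsIntegralClass c ↔ ∃ v : K3Index → ℤ, η c = fun i => (v i : ℂ))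
    (hcup : ∀ a b : complexBetti S (2 * 1),
      cupProduct (rfl : 2 * 1 + 2 * 1 = 2 * 2) a b = k3Form (η a) (η b) • p)
    [Subsingleton (complexBetti S 1)]
    (hKS : ∀ (k : ℕ) (z : complexBetti (S ⊗ S) k), z ∈ Submodule.span ℂ
      {v | ∃ (i j : ℕ) (h : i + j = k) (a : complexBetti S i) (w : complexBetti S j),
        v = cupProduct h (complexBetti.map (fst S S) i a) (complexBetti.map (snd S S) j w)})
    (A : HodgeModel 2 S) (M : HodgeModel 4 (S ⊗ S)) (hcupS : CupPreservesHodgeType 2 S)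
    (hcupP : CupPreservesHodgeType 4 (S ⊗ S))
    (hAll : ∀ G : complexBetti S (2 * 1) →ₗ[ℂ] complexBetti S (2 * 1),
      (∀ x, IsRationalClass x → IsRationalClass (G x)) →
      (∀ (i j : ℕ) x, IsOfHodgeType 2 S (2 * 1) i j x → IsOfHodgeType 2 S (2 * 1) i j (G x)) →
      ∃ γ ∈ algebraicClasses (S ⊗ S) 2, ∀ x : complexBetti S (2 * 1),
        G x = complexGysin μ (IsSmoothProjective.tensor_holds hK3.isSmoothProjective hK3.isSmoothProjective)
          hK3.isSmoothProjective (fst S S) (rfl : 2 * 1 + 2 * 2 + 2 * 2 = 2 * 1 + 2 * (2 + 2))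
          (cupProduct (rfl : 2 * 1 + 2 * 2 = 2 * 1 + 2 * 2) (complexBetti.map (snd S S) (2 * 1) x) γ))
    {c : complexBetti (S ⊗ S) (2 * 2)} (hc : IsRationalClass c)
    (hc22 : IsOfHodgeType 4 (S ⊗ S) (2 * 2) 2 2 c) : c ∈ algebraicClasses (S ⊗ S) 2 := by
  have hS := hK3.isSmoothProjective
  have hBs : ∀ a b : complexBetti S (2 * 1), k3Form (η a) (η b) = k3Form (η b) (η a) :=
    fun a b ↦ k3Form_comm _ _
  obtain ⟨c₀, hc₀, hFI⟩ := fibreIntegral_square_of_kunneth μ hS (hKS _) hp0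
  have hpp := cross_top_ne_zero μ hS (hKS _) hp0
  have hbVb : ∀ k, ((Pi.basisFun ℂ K3Index).map η.symm) k = η.symm (Pi.single k 1) := fun k ↦ by
    rw [Module.Basis.map_apply, Pi.basisFun_apply]
  obtain ⟨u, t₄, t₀, hcn⟩ := kunneth_four μ hS hKS hp0 ((Pi.basisFun ℂ K3Index).map η.symm) c
  simp only [hbVb] at hcn
  obtain ⟨f, hf⟩ : ∃ f : complexBetti S (2 * 1) →ₗ[ℂ] complexBetti S (2 * 1),
      ∀ x, f x = ∑ k, k3Form (η x) (η (u k)) • η.symm (Pi.single k 1) :=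
    ⟨∑ k, ((k3FormC.compl₁₂ η.toLinearMap η.toLinearMap : LinearMap.BilinForm ℂ _).flip (u k)).smulRight
      (η.symm (Pi.single k 1)), fun x ↦ by simp [LinearMap.sum_apply, LinearMap.smulRight_apply]⟩
  obtain ⟨γ, hγalg, hγact⟩ := hAll f
    (fun x hx ↦ by rw [hf]; exact isRationalClass_act_of_normalForm hK3 η hint hcup hpint hpp hc hcn hx)
    (fun i j x hx ↦ by
      rw [hf]; exact isOfHodgeType_act_of_normalForm μ hS A M hcupS hcupP hcup hBs hpp hc22 hcn hx)
  obtain ⟨uγ, r₄, r₀, hγn⟩ := kunneth_four μ hS hKS hp0 ((Pi.basisFun ℂ K3Index).map η.symm) γ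
  simp only [hbVb] at hγn
  -- `u = c₀ • uγ`: both act as `f`
  have hw : ∀ x, ∑ k, k3Form (η x) (η ((u - c₀ • uγ) k)) • η.symm (Pi.single k 1) = 0 := fun x ↦ by
    have h := hγact x
    rw [hγn, corr_normalForm hS hcup μ hFI, hf] at h
    rw [act_sub, act_smul, ← h, sub_self]
  have hu : u = c₀ • uγ := sub_eq_zero.1 (eq_zero_of_act_eq_zero η _ hw)
  have hγm : γ - r₄ • complexBetti.map (snd S S) (2 * 2) p - r₀ • complexBetti.map (fst S S) (2 * 2) p =
      ∑ k, cupProduct (rfl : 2 * 1 + 2 * 1 = 2 * 2)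
        (complexBetti.map (fst S S) (2 * 1) (η.symm (Pi.single k 1)))
        (complexBetti.map (snd S S) (2 * 1) (uγ k)) := by rw [hγn]; abel
  have hsndp : complexBetti.map (snd S S) (2 * 2) p ∈ algebraicClasses (S ⊗ S) 2 := by
    have h := cupProduct_map_fst_map_snd_mem_algebraicClasses hS hS (l := 0) (k := 2)
      (a := singularCohomology.one ℂ (ComplexPoints S)) (b := p)
      (by rw [algebraicClasses_zero]; exact Submodule.mem_top)
      (mem_algebraicClasses_of_degree_top hS (by norm_num) p)
    rwa [singularCohomology.map_one, one_cupProduct] at h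
  have hfstp : complexBetti.map (fst S S) (2 * 2) p ∈ algebraicClasses (S ⊗ S) 2 := by
    have h := cupProduct_map_fst_map_snd_mem_algebraicClasses hS hS (l := 2) (k := 0) (a := p)
      (b := singularCohomology.one ℂ (ComplexPoints S))
      (mem_algebraicClasses_of_degree_top hS (by norm_num) p)
      (by rw [algebraicClasses_zero]; exact Submodule.mem_top)
    rwa [singularCohomology.map_one, cupProduct_one] at h
  rw [hcn, hu, mid_smul, ← hγm]
  exact Submodule.add_mem _ (Submodule.add_mem _
    (Submodule.smul_mem _ _ (Submodule.sub_mem _ (Submodule.sub_mem _ hγalg (Submodule.smul_mem _ _ hsndp))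
      (Submodule.smul_mem _ _ hfstp)))
    (Submodule.smul_mem _ _ hsndp)) (Submodule.smul_mem _ _ hfstp)

/-- **The Künneth criterion (K) of the sibling file `…SquareHodgeOfSqrtTwo`
(`squareHodgeOfSqrtTwo_of_kunnethCriterion`, where it is the residual formal debt of
stmt-HodgeConjecture-13682), DISCHARGED from the standard inputs**: for every projective K3 surface `S`,
if every rational type-preserving endomorphism of `H²(S(ℂ); ℂ)` is induced by an algebraic class of
codimension `2` on `S ⊗ S` and Lefschetz `(1,1)` holds for `S`, then `HodgeConjectureFor 4 (S ⊗ S)` —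
GRANTED Künneth spanning, `b₁ = 0`, Hodge models, the multiplicativity of Hodge types and markings.
Degrees `≠ 4` as in `hodgeConjectureFor_square`; degree `4` is
`mem_algebraicClasses_of_typeTwoTwo_of_endomorphisms`. [cite: Varesco2023, §2 (p. 8)]
[cite: VoisinHodgeI2002, §11.3.3 Lemma 11.41] [cite: HatcherAT2002, §3.2 Thm. 3.16] -/
theorem kunnethCriterion_of_kunneth
    (hK : ∀ ⦃m' n' : ℕ⦄ ⦃Y' Z' : SchemeOver ℂ⦄, IsSmoothProjective m' Y' → IsSmoothProjective n' Z' →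
      ∀ (k : ℕ) (z : complexBetti (Y' ⊗ Z') k), z ∈ Submodule.span ℂ
        {v | ∃ (i j : ℕ) (h : i + j = k) (b : complexBetti Y' i) (w : complexBetti Z' j),
          v = cupProduct h (complexBetti.map (fst Y' Z') i b) (complexBetti.map (snd Y' Z') j w)})
    (hb₁ : ∀ S : SchemeOver ℂ, IsK3Surface S → Subsingleton (complexBetti S 1))
    (hM : ∀ (n : ℕ) (X : SchemeOver ℂ), nonempty_hodgeModel n X)
    (hcupT : ∀ (n : ℕ) (X : SchemeOver ℂ), IsSmoothProjective n X → CupPreservesHodgeType n X)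
    (hmark : Huybrechts_K3_marking_exists) (μ : OrientationFamily) (_hμ : μ.HasPoincareDuality)
    (S : SchemeOver ℂ)
    (hS : IsSmoothProjective 2 S ∧ Subsingleton (structureSheafCohomology S.left 1) ∧
      ∃ (A : HodgeModel 2 S) (η : MForm 𝓘(ℝ, A.model) A.carrier ℂ 2),
        IsHolomorphicInCharts η ∧ ∀ x, η x ≠ 0)
    (hAll : ∀ G : complexBetti S (2 * 1) →ₗ[ℂ] complexBetti S (2 * 1),
      (∀ x, IsRationalClass x → IsRationalClass (G x)) →
      (∀ (i j : ℕ) x, IsOfHodgeType 2 S (2 * 1) i j x → IsOfHodgeType 2 S (2 * 1) i j (G x)) →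
      ∃ γ ∈ algebraicClasses (S ⊗ S) 2, ∀ x : complexBetti S (2 * 1),
        G x = complexGysin μ (IsSmoothProjective.tensor_holds hS.1 hS.1) hS.1
          (SemiCartesianMonoidalCategory.fst S S)
          (rfl : 2 * 1 + 2 * 2 + 2 * 2 = 2 * 1 + 2 * (2 + 2))
          (cupProduct (rfl : 2 * 1 + 2 * 2 = 2 * 1 + 2 * 2)
            (complexBetti.map (SemiCartesianMonoidalCategory.snd S S) (2 * 1) x) γ))
    (hL11 : ∀ c : complexBetti S (2 * 1), IsRationalClass c → IsOfHodgeType 2 S (2 * 1) 1 1 c →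
      c ∈ algebraicClasses S 1) :
    HodgeConjectureFor 4 (S ⊗ S) := by
  have hK3 : IsK3Surface S := hS
  have hS2 := hK3.isSmoothProjective
  haveI := hb₁ S hK3
  have hP : IsSmoothProjective 4 (S ⊗ S) := IsSmoothProjective.tensor_holds hS2 hS2
  obtain ⟨M⟩ := (hM 4 (S ⊗ S)).nonempty hP
  obtain ⟨A⟩ := hK3.nonempty_hodgeModel
  obtain ⟨η, p, _, hp0, ⟨hpint, -, hint, hcup, -, -⟩, -⟩ := hmark.elim hK3
  have hKS := hK hS2 hS2
  have hcupS := hcupT 2 S hS2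
  have hcupP := hcupT 4 (S ⊗ S) hP
  have hpp := cross_top_ne_zero μ hS2 (hKS _) hp0
  have h1 : singularCohomology.one ℂ (ComplexPoints S) ∈ algebraicClasses S 0 := by
    rw [algebraicClasses_zero]; exact Submodule.mem_top
  have hpalg : p ∈ algebraicClasses S 2 := mem_algebraicClasses_of_degree_top hS2 (by norm_num) p
  refine ⟨⟨M⟩, fun q ↦ ?_⟩
  match q with
  | 0 => exact fun c _ _ ↦ hodgeConjectureFor_codim_zero c
  | 1 =>
    intro c hc h11
    obtain ⟨a, b, hcn⟩ := kunneth_two μ hS2 hKS c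
    obtain ⟨har, hbr⟩ := isRationalClass_of_kunneth_two hK3 η hint hcup hpint hpp hc hcn
    obtain ⟨ha1, hb1⟩ := isOfHodgeType_of_kunneth_two μ hS2 A M hcupS hcupP hcup hpp h11 hcn
    have ha : complexBetti.map (fst S S) (2 * 1) a ∈ algebraicClasses (S ⊗ S) 1 := by
      have h := cupProduct_map_fst_map_snd_mem_algebraicClasses hS2 hS2 (l := 1) (k := 0) (hL11 a har ha1) h1
      rwa [singularCohomology.map_one, cupProduct_one] at h
    have hb : complexBetti.map (snd S S) (2 * 1) b ∈ algebraicClasses (S ⊗ S) 1 := by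
      have h := cupProduct_map_fst_map_snd_mem_algebraicClasses hS2 hS2 (l := 0) (k := 1) h1 (hL11 b hbr hb1)
      rwa [singularCohomology.map_one, one_cupProduct] at h
    rw [hcn]
    exact Submodule.add_mem _ ha hb
  | 2 =>
    exact fun c hc h22 ↦ mem_algebraicClasses_of_typeTwoTwo_of_endomorphisms μ hK3 η hp0 hpint hint hcup
      hKS A M hcupS hcupP hAll hc h22
  | 3 =>
    intro c hc h33
    obtain ⟨a, b, hcn⟩ := kunneth_six μ hS2 hKS hp0 c
    obtain ⟨har, hbr⟩ := isRationalClass_of_kunneth_six hK3 η hint hcup hpint hpp hc hcn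
    obtain ⟨ha1, hb1⟩ := isOfHodgeType_of_kunneth_six μ hS2 A M hcupS hcupP hcup hpp h33 hcn
    rw [hcn]
    exact Submodule.add_mem _
      (cupProduct_map_fst_map_snd_mem_algebraicClasses hS2 hS2 (l := 1) (k := 2) (hL11 a har ha1) hpalg)
      (cupProduct_map_fst_map_snd_mem_algebraicClasses hS2 hS2 (l := 2) (k := 1) hpalg (hL11 b hbr hb1))
  | 4 => exact fun c _ _ ↦ mem_algebraicClasses_of_degree_top hP (by norm_num) c
  | q + 5 =>
    intro c _ _
    haveI := subsingleton_complexBetti hP (show 2 * 4 < 2 * (q + 5) by omega)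
    rw [Subsingleton.elim c 0]
    exact Submodule.zero_mem _

end Summit.HodgeConjecture.HodgeConjecture.Theorems.NikulinTwinTransport

end
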